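import Literature.NumberTheory.DiophantineGeometry.AVGaloisModule
import Literature.AlgebraicGeometry.Resolution.ResidueFieldsIntegralMorphisms
import Literature.AlgebraicGeometry.Motives.AbelianVarietyLie
import Mathlib.AlgebraicGeometry.ResidueField
import HarnessLib

/-!
# [AbsTopIII] Rmk. 1.5.4 (iii): rational points over a relatively algebraically closed subfield — `N`-th roots descend

Mochizuki, *Topics in Absolute Anabelian Geometry III*, §1, Remark 1.5.4 (iii), p. 34 (lit key
`paper:url-5493eb38cbb7`), verbatim: "observe that if, for instance, `I` is an infinite set, then the
field `k := ℚ_p(x_i)_{i ∈ I}` [which is not a finitely generated extension of `ℚ_p`] constitutes an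
example of a Kummer-faithful field which is not sub-`p`-adic. Indeed, if, for `H`, `A` as in
Definition 1.5, `0 ≠ f ∈ A(k_H)` lies in the kernel of the associated Kummer map, then observe that
there exists some finite subset `I′ ⊆ I` such that if we set `k′ := ℚ_p(x_i)_{i ∈ I′}`, then, for some
finite extension `k′_H ⊆ k_H` of `k′`, we may assume that `A` descends to a semi-abelian variety `A′`
over `k′_H`, that `f ∈ A′(k′_H) ⊆ A(k_H)`, and that `k_H = k′_H(x_i)_{i ∈ I″}`, where we set
`I″ := I ∖ I′`. Since `k′_H` is algebraically closed in `k_H`, it thus follows that all roots of `f`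
defined over `k_H` are in fact defined over `k′_H`. Thus, the existence of `f` contradicts the fact
that the sub-`p`-adic field `k′_H` is Kummer-faithful."  (Gloss, not print: `k_H = k′_H(x_i)_{i ∈ I″}`
says that `k_H` is purely transcendental over the finitely generated field `k′_H`.)

This file IS the step "all roots of `f` defined over `k_H` are in fact defined over `k′_H`" for
ABELIAN varieties: once `A` and the point are defined over a subfield `E ⊆ k'` RELATIVELY ALGEBRAICALLY
CLOSED in `k'`, every `k'`-rational `N`-th root is `E`-rational, because `[N]` is FINITE (char. `0`)
and the residue field of the root is then algebraic over `E`.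

PROOF-ONLY file (Mathlib + tree), route memo F0371-AV-ROUTE junctions J3/J4 (cell abc-iut):

* `AlgPoints.pt_extendScalars`, `AlgPoints.exists_eq_extendScalars_of_range_resHom_subset` — a
  `k'`-point `Q` of an `E`-scheme whose residue-field embedding `κ(Q) → k'` lands in `E` comes from an
  `E`-point (`Spec k' → Spec E` is an epimorphism);
* `AlgPoints.range_descResidueField_specMap_subset` — the residue embedding of the structure point
  `Spec k' → Spec E` lands in `E`;
* `AlgPoints.exists_eq_extendScalars_of_isAlgebraic_residueField` — if `κ(Q)` is algebraic over the
  residue field of `Spec E` (along the structure morphism) and `E` is relatively algebraically closed in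
  `k'`, then `Q` is `E`-rational;
* `AlgPoints.exists_eq_extendScalars_of_map_eq_extendScalars` — a `k'`-point mapping under a FINITE
  `E`-morphism to an `E`-rational point is `E`-rational (`E` relatively algebraically closed in `k'`);
* `AbelianVariety.exists_eq_extendScalars_of_pow_eq` — **for an abelian variety `A / E`
  (char. `0`), `Q ∈ A(k')` with `Q ^ N = x_{k'}` for some `x ∈ A(E)`, `N ≥ 1`, is `E`-rational**
  (`[N]` is an isogeny: `isIsogeny_zsmul_id_of_cast_ne_zero`).

Nothing here bears on [IUTchIII] Cor. 3.12.
v2: module docstring re-quoted VERBATIM from p. 34 (RQ7 note abc-iut-aud-15); declarations unchanged.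
-/

noncomputable section

universe u

open CategoryTheory AlgebraicGeometry Opposite IsLocalRing

namespace Literature.AnabelianGeometry.AbsoluteAnabelian.AbsTopIII

open Literature.AlgebraicGeometry.Motives Literature.AlgebraicGeometry.Motives.AlgPoints

section Points

variable {E : Type u} [Field E] (Y : SchemeOver E) (k' : Type u) [Field k'] [Algebra E k']

/-- The underlying point of the scalar extension `P_{k'}` of an `E`-point `P` is the point of `P`
(`Spec k' → Spec E` hits the unique point). [cite: MochizukiAbsTopIII2015, Rmk 1.5.4 (iii) p.34] -/
theorem AlgPoints.pt_extendScalars (P : AlgPoints Y E) : (extendScalars Y E k' P).pt = P.pt := by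
  change (Spec.map (CommRingCat.ofHom (algebraMap E k')) ≫ P.left).base (closedPoint k') =
    P.left.base (closedPoint E)
  rw [Scheme.Hom.comp_base, TopCat.coe_comp, Function.comp_apply]
  congr 1
  exact Subsingleton.elim _ _

/-- An `L`-point `Q` of the `E`-scheme `Y` whose residue embedding `κ(Q.pt) → k'` takes values in
(the image of) `E` is the scalar extension of an `E`-point: `Q = (Q₀)_{k'}` with
`Q₀ = Spec E → Spec κ(Q.pt) → Y`; the compatibility with the structure maps holds because
`Spec k' → Spec E` is an epimorphism. [cite: MochizukiAbsTopIII2015, Rmk 1.5.4 (iii) p.34] -/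
theorem AlgPoints.exists_eq_extendScalars_of_range_resHom_subset (Q : AlgPoints Y k')
    (hQ : Set.range Q.resHom.hom ⊆ Set.range (algebraMap E k')) :
    ∃ Q₀ : AlgPoints Y E, extendScalars Y E k' Q₀ = Q := by
  -- factor the residue embedding through `E`
  have hinj : Function.Injective (algebraMap E k') := (algebraMap E k').injective
  have hfac : ∀ a, ∃ b, algebraMap E k' b = Q.resHom.hom a := fun a => hQ ⟨a, rfl⟩
  choose ψ₀ hψ₀ using hfac
  let ψ : Y.left.residueField Q.pt →+* E :=
    { toFun := ψ₀
      map_one' := hinj (by rw [hψ₀, map_one, map_one])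
      map_mul' := fun a b => hinj (by rw [hψ₀, map_mul, map_mul, hψ₀, hψ₀])
      map_zero' := hinj (by rw [hψ₀, map_zero, map_zero])
      map_add' := fun a b => hinj (by rw [hψ₀, map_add, map_add, hψ₀, hψ₀]) }
  have hψ : (algebraMap E k').comp ψ = Q.resHom.hom := RingHom.ext fun a => hψ₀ a
  -- the `E`-point
  let q₀ : Spec (.of E) ⟶ Y.left := Spec.map (CommRingCat.ofHom ψ) ≫ Y.left.fromSpecResidueField Q.pt
  have hq : Spec.map (CommRingCat.ofHom (algebraMap E k')) ≫ q₀ = Q.left := by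
    change Spec.map _ ≫ Spec.map _ ≫ _ = _
    rw [← Spec.map_comp_assoc, ← CommRingCat.ofHom_comp, hψ]
    exact Scheme.descResidueField_stalkClosedPointTo_fromSpecResidueField k' Y.left Q.left
  haveI : Epi (Spec.map (CommRingCat.ofHom (algebraMap E k'))) := epi_specMap_algebraMap E k'
  have hw : q₀ ≫ Y.hom = (specOver E E).hom := by
    rw [← cancel_epi (Spec.map (CommRingCat.ofHom (algebraMap E k'))), ← Category.assoc]
    have h1 : (Spec.map (CommRingCat.ofHom (algebraMap E k')) ≫ q₀) ≫ Y.hom = (specOver E k').hom :=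
      (congrArg (fun g => g ≫ Y.hom) hq).trans (Over.w Q)
    rw [h1]
    change Spec.map _ = Spec.map _ ≫ Spec.map _
    rw [← Spec.map_comp, ← CommRingCat.ofHom_comp, ← IsScalarTower.algebraMap_eq E E k']
  refine ⟨Over.homMk q₀ hw, ?_⟩
  apply Over.OverMorphism.ext
  change Spec.map (CommRingCat.ofHom (algebraMap E k')) ≫ q₀ = Q.left
  exact hq

/-- The residue embedding `κ(p) → k'` of the structure point `Spec k' → Spec E` (at the unique point
`p` of `Spec E`) takes values in the image of `E`: every element of `κ(p)` is the residue of a global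
function `a ∈ E = Γ(Spec E)`, whose value is `algebraMap E k' a`.
[cite: MochizukiAbsTopIII2015, Rmk 1.5.4 (iii) p.34] -/
theorem AlgPoints.range_descResidueField_specMap_subset :
    Set.range (Scheme.descResidueField (Scheme.stalkClosedPointTo
        (Spec.map (CommRingCat.ofHom (algebraMap E k'))))).hom ⊆
      Set.range (algebraMap E k') := by
  rintro _ ⟨c, rfl⟩
  let f : Spec (.of k') ⟶ Spec (.of E) := Spec.map (CommRingCat.ofHom (algebraMap E k'))
  let x₀ : (⊤ : (Spec (.of E)).Opens) := ⟨f.base (closedPoint k'), trivial⟩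
  -- `c` is the residue of a germ, and germs come from global sections (`E` is a field)
  obtain ⟨s, rfl⟩ := (Spec (.of E)).residue_surjective _ c
  have hU : IsAffineOpen (⊤ : (Spec (.of E)).Opens) := isAffineOpen_top (Spec (.of E))
  letI := TopCat.Presheaf.algebra_section_stalk (Spec (.of E)).presheaf x₀
  haveI := hU.isLocalization_stalk x₀
  have hΓ : IsField Γ(Spec (.of E), ⊤) :=
    (Scheme.ΓSpecIso (.of E)).commRingCatIsoToRingEquiv.toMulEquiv.isField (Field.toIsField E)
  have h0 : (0 : Γ(Spec (.of E), ⊤)) ∉ (hU.primeIdealOf x₀).asIdeal.primeCompl :=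
    fun h => h (Ideal.zero_mem _)
  have hsurj : Function.Surjective
      (algebraMap Γ(Spec (.of E), ⊤) ((Spec (CommRingCat.of E)).presheaf.stalk x₀.1)) :=
    (IsField.localization_map_bijective h0 hΓ).2
  obtain ⟨a, ha⟩ := hsurj s
  -- the residue of the germ of `a` maps to `algebraMap E k' (ΓSpecIso a)`
  refine ⟨(Scheme.ΓSpecIso (.of E)).hom a, ?_⟩
  rw [← ha]
  change ((Scheme.ΓSpecIso (.of E)).hom ≫ CommRingCat.ofHom (algebraMap E k')) a =
    ((Spec (.of E)).presheaf.germ ⊤ _ trivial ≫ (Spec (.of E)).residue _ ≫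
      Scheme.descResidueField (Scheme.stalkClosedPointTo f)) a
  rw [Scheme.residue_descResidueField, Scheme.germ_stalkClosedPointTo_Spec]

/-- The structure morphism of an `E`-scheme is a bijection on the residue field of an `E`-RATIONAL
point: for `x ∈ X(E)`, `κ(p) → κ(x.pt)` (`p` the image point in `Spec E`) is surjective (and, as a
field homomorphism, injective) — its composite with the residue map of the section
`x : Spec E → X` is the residue map of `x ≫ (X → Spec E) = 𝟙`, an isomorphism.
[cite: MochizukiAbsTopIII2015, Rmk 1.5.4 (iii) p.34] -/
theorem AlgPoints.surjective_residueFieldMap_pt (X : SchemeOver E) (x : AlgPoints X E) :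
    Function.Surjective (X.hom.residueFieldMap x.pt).hom := by
  -- the section identity `x ≫ (X → Spec E) = 𝟙`
  have hsec : x.left ≫ X.hom = 𝟙 (Spec (.of E)) := by
    rw [Over.w x]
    change Spec.map (CommRingCat.ofHom (algebraMap E E)) = 𝟙 _
    rw [Algebra.algebraMap_self, CommRingCat.ofHom_id]
    exact Spec.map_id _
  let c : Spec (.of E) := closedPoint E
  -- residue maps: `(x ≫ X.hom)^* = X.hom^* ∘ x^*` at `c`, and `(x ≫ X.hom)^* = 𝟙^*` is bijective
  have key : ∀ g : Spec (.of E) ⟶ Spec (.of E), g = 𝟙 _ →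
      Function.Bijective (g.residueFieldMap c).hom := by
    rintro _ rfl
    rw [Scheme.residueFieldMap_id]
    exact Function.bijective_id
  have hbij0 := key (x.left ≫ X.hom) hsec
  have hcomp : (x.left ≫ X.hom).residueFieldMap c =
      X.hom.residueFieldMap (x.left.base c) ≫ x.left.residueFieldMap c :=
    Scheme.residueFieldMap_comp _ _ _
  -- so `x^* ∘ X.hom^*` is bijective
  have hbij : Function.Bijective
      ((X.hom.residueFieldMap (x.left.base c) ≫ x.left.residueFieldMap c).hom) := hcomp ▸ hbij0
  have hinj : Function.Injective (x.left.residueFieldMap c).hom :=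
    (x.left.residueFieldMap c).hom.injective
  intro b
  obtain ⟨t, ht⟩ := hbij.2 ((x.left.residueFieldMap c).hom b)
  exact ⟨t, hinj ht⟩

end Points

section Finite

variable {E : Type u} [Field E] {X Y : SchemeOver E} (k' : Type u) [Field k'] [Algebra E k']

omit [Algebra E k'] in
/-- Variant of `AlgPoints.range_descResidueField_specMap_subset` for a morphism EQUAL to the
structure point `Spec k' → Spec E`. [cite: MochizukiAbsTopIII2015, Rmk 1.5.4 (iii) p.34] -/
theorem AlgPoints.range_descResidueField_subset_of_eq [Algebra E k'] {f : Spec (.of k') ⟶ Spec (.of E)}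
    (hf : f = Spec.map (CommRingCat.ofHom (algebraMap E k'))) :
    Set.range (Scheme.descResidueField (Scheme.stalkClosedPointTo f)).hom ⊆
      Set.range (algebraMap E k') := by
  subst hf
  exact AlgPoints.range_descResidueField_specMap_subset k'

/-- **The residue field of a `k'`-point lying over an `E`-rational point under a FINITE morphism
embeds into the algebraic closure of `E` in `k'`**: for a finite `E`-morphism `f : Y → X`, an
`E`-rational point `x ∈ X(E)` and a `k'`-point `Q ∈ Y(k')` with `f(Q) = x_{k'}`, every value of the
residue embedding `κ(Q.pt) → k'` is algebraic over `E` (`κ(Q.pt)` is algebraic over `κ(x.pt)`,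
tree `Scheme.Hom.isAlgebraic_residueField_of_isIntegralHom`, and `κ(x.pt) = E`).
[cite: MochizukiAbsTopIII2015, Rmk 1.5.4 (iii) p.34] -/
theorem AlgPoints.isAlgebraic_resHom_of_map_eq_extendScalars (f : Y ⟶ X) [IsFinite f.left]
    (x : AlgPoints X E) (Q : AlgPoints Y k')
    (h : AlgPoints.map f Q = extendScalars X E k' x) (a : Y.left.residueField Q.pt) :
    IsAlgebraic E (Q.resHom.hom a) := by
  classical
  -- the three residue fields and the maps between them
  let y : Y.left := Q.pt
  let x₁ : X.left := f.left.base y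
  have hx₁ : x₁ = x.pt := by
    change (AlgPoints.map f Q).pt = x.pt
    rw [h, AlgPoints.pt_extendScalars]
  let r₁ : X.left.residueField x₁ ⟶ Y.left.residueField y := f.left.residueFieldMap y
  let r₀ : (Spec (.of E)).residueField (X.hom.base x₁) ⟶ X.left.residueField x₁ :=
    X.hom.residueFieldMap x₁
  -- `κ(y)` is algebraic over `κ(x₁)` (finite morphism) and `κ(x₁) = image of κ(p)` (rational point)
  letI : Algebra (X.left.residueField x₁) (Y.left.residueField y) := r₁.hom.toAlgebra
  haveI halg₁ : Algebra.IsAlgebraic (X.left.residueField x₁) (Y.left.residueField y) :=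
    Literature.AlgebraicGeometry.Resolution.Scheme.Hom.isAlgebraic_residueField_of_isIntegralHom
      f.left y
  have hsurj₀ : Function.Surjective r₀.hom := by
    have : ∀ z : X.left, z = x.pt → Function.Surjective (X.hom.residueFieldMap z).hom := by
      rintro _ rfl
      exact AlgPoints.surjective_residueFieldMap_pt X x
    exact this x₁ hx₁
  letI : Algebra ((Spec (.of E)).residueField (X.hom.base x₁)) (X.left.residueField x₁) :=
    r₀.hom.toAlgebra
  letI : Algebra ((Spec (.of E)).residueField (X.hom.base x₁)) (Y.left.residueField y) :=
    (r₀ ≫ r₁).hom.toAlgebra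
  haveI : IsScalarTower ((Spec (.of E)).residueField (X.hom.base x₁)) (X.left.residueField x₁)
      (Y.left.residueField y) := IsScalarTower.of_algebraMap_eq fun _ => rfl
  haveI halg₀ : Algebra.IsAlgebraic ((Spec (.of E)).residueField (X.hom.base x₁))
      (X.left.residueField x₁) := by
    refine ⟨fun b => ?_⟩
    obtain ⟨t, rfl⟩ := hsurj₀ b
    exact isAlgebraic_algebraMap t
  haveI : Algebra.IsAlgebraic ((Spec (.of E)).residueField (X.hom.base x₁))
      (Y.left.residueField y) := Algebra.IsAlgebraic.trans _ (X.left.residueField x₁) _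
  -- a polynomial relation for `a` over `κ(p)`, pushed to `k'` along `Q.resHom`
  obtain ⟨p, hp0, hpa⟩ :=
    (Algebra.IsAlgebraic.isAlgebraic (R := (Spec (.of E)).residueField (X.hom.base x₁)) a)
  let m : (Spec (.of E)).residueField (X.hom.base x₁) ⟶ CommRingCat.of k' := (r₀ ≫ r₁) ≫ Q.resHom
  have e1 : m = (f.left ≫ X.hom).residueFieldMap y ≫ Q.resHom := by
    change (X.hom.residueFieldMap (f.left.base y) ≫ f.left.residueFieldMap y) ≫ Q.resHom = _
    rw [← Scheme.residueFieldMap_comp]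
    rfl
  have e2 := Scheme.descResidueField_stalkClosedPointTo_comp (f := f.left ≫ X.hom)
    (g := (Q.left : Spec (.of k') ⟶ Y.left))
  have hm : m = Scheme.descResidueField (Scheme.stalkClosedPointTo
      ((Q.left : Spec (.of k') ⟶ Y.left) ≫ f.left ≫ X.hom)) := e1.trans e2.symm
  have hrange : Set.range m.hom ⊆ Set.range (algebraMap E k') := by
    rw [hm]
    refine AlgPoints.range_descResidueField_subset_of_eq k' ?_
    have hw : (AlgPoints.map f Q).left ≫ X.hom = (specOver E k').hom := Over.w _
    rw [← Category.assoc]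
    exact hw
  -- the pushed polynomial has coefficients in `E`
  let q : Polynomial k' := p.map m.hom
  have hq0 : q ≠ 0 := by
    intro hq
    exact hp0 ((Polynomial.map_eq_zero_iff m.hom.injective).mp hq)
  have hqa : q.IsRoot (Q.resHom.hom a) := by
    rw [Polynomial.IsRoot.def, Polynomial.eval_map]
    have : Q.resHom.hom (Polynomial.aeval a p) = 0 := by rw [hpa, map_zero]
    rw [Polynomial.aeval_def, Polynomial.hom_eval₂] at this
    exact this
  have hlifts : q ∈ Polynomial.lifts (algebraMap E k') := by
    refine (Polynomial.lifts_iff_coeff_lifts q).mpr fun n => ?_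
    rw [Polynomial.coeff_map]
    exact hrange ⟨p.coeff n, rfl⟩
  obtain ⟨p', hp'⟩ := (Polynomial.mem_lifts q).mp hlifts
  refine ⟨p', ?_, ?_⟩
  · rintro rfl
    exact hq0 (by rw [← hp', Polynomial.map_zero])
  · rw [Polynomial.aeval_def, ← Polynomial.eval_map, hp']
    exact hqa

/-- **`k'`-points over `E`-rational points of a FINITE morphism are `E`-rational when `E` is
relatively algebraically closed in `k'`**: for a finite `E`-morphism `f : Y → X`, `x ∈ X(E)` and
`Q ∈ Y(k')` with `f(Q) = x_{k'}`, if every element of `k'` algebraic over `E` lies in `E`, then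
`Q = (Q₀)_{k'}` for an `E`-point `Q₀ ∈ Y(E)`. [cite: MochizukiAbsTopIII2015, Rmk 1.5.4 (iii) p.34] -/
theorem AlgPoints.exists_eq_extendScalars_of_map_eq_extendScalars (f : Y ⟶ X) [IsFinite f.left]
    (hrac : ∀ z : k', IsAlgebraic E z → z ∈ Set.range (algebraMap E k'))
    (x : AlgPoints X E) (Q : AlgPoints Y k') (h : AlgPoints.map f Q = extendScalars X E k' x) :
    ∃ Q₀ : AlgPoints Y E, extendScalars Y E k' Q₀ = Q := by
  refine AlgPoints.exists_eq_extendScalars_of_range_resHom_subset Y k' Q ?_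
  rintro _ ⟨a, rfl⟩
  exact hrac _ (AlgPoints.isAlgebraic_resHom_of_map_eq_extendScalars k' f x Q h a)

end Finite

section AbelianVariety

variable {E : Type u} [Field E] [CharZero E] (A : AbelianVariety E) (k' : Type u) [Field k']
  [Algebra E k']

omit [CharZero E] in
/-- Multiplication by `N` on an abelian variety acts on `L`-points as `P ↦ P ^ N` (group law written
multiplicatively): `AlgPoints.map [N] P = P ^ N`. [cite: MochizukiAbsTopIII2015, Rmk 1.5.4 (iii) p.34] -/
theorem AbelianVariety.map_zsmul_id_points {L : Type u} [Field L] [Algebra E L] (n : ℤ)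
    (P : A.Points L) : AlgPoints.map ((n • 𝟙 A).hom.hom.hom) P = P ^ n := by
  rw [AlgPoints.map_apply, AbelianVariety.hom_zsmul_id, GrpObj.comp_zpow, Category.comp_id]

/-- **`N`-th roots of rational points are rational over a relatively algebraically closed subfield**
([AbsTopIII] Rmk. 1.5.4 (iii) p. 34: "Since `k′_H` is algebraically closed in `k_H`, it thus follows
that all roots of `f` defined over `k_H` are in fact defined over `k′_H`", for abelian varieties): let `A` be an abelian variety over
a field `E` of characteristic `0`, `k' ⊇ E` an extension in which `E` is relatively algebraically
closed, `x ∈ A(E)` and `Q ∈ A(k')` with `Q ^ N = x_{k'}` for some `N ≥ 1`. Then `Q = (Q₀)_{k'}` for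
some `Q₀ ∈ A(E)` — because `[N] : A → A` is FINITE (an isogeny,
`isIsogeny_zsmul_id_of_cast_ne_zero`) and maps `Q` to the `E`-rational point `x`.
[cite: MochizukiAbsTopIII2015, Rmk 1.5.4 (iii) p.34] -/
theorem AbelianVariety.exists_eq_extendScalars_of_pow_eq
    (hrac : ∀ z : k', IsAlgebraic E z → z ∈ Set.range (algebraMap E k'))
    (x : A.Points E) (Q : A.Points k') (N : ℕ) (hN : 0 < N)
    (h : Q ^ N = extendScalars A.X E k' x) :
    ∃ Q₀ : A.Points E, extendScalars A.X E k' Q₀ = Q := by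
  have hiso := AbelianVariety.isIsogeny_zsmul_id_of_cast_ne_zero (A := A) (N : ℤ)
    (by exact_mod_cast hN.ne')
  haveI : IsFinite ((N : ℤ) • 𝟙 A).hom.hom.hom.left := hiso.2
  refine AlgPoints.exists_eq_extendScalars_of_map_eq_extendScalars k' ((N : ℤ) • 𝟙 A).hom.hom.hom
    hrac x Q ?_
  rw [AbelianVariety.map_zsmul_id_points, zpow_natCast, h]

end AbelianVariety


end Literature.AnabelianGeometry.AbsoluteAnabelian.AbsTopIII
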